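import Literature.Probability.RandomPlanarGeometry.ConformalRestrictionLocal
import Literature.Probability.RandomPlanarGeometry.LoewnerSlitTheorem
import Literature.Probability.RandomPlanarGeometry.RestrictionMeasuresFiveEighthsAssembly
import Literature.Probability.RandomPlanarGeometry.SLEKappaRhoAssemblyProofs
import Literature.Probability.RandomPlanarGeometry.SLERestrictionLemmasProofs
import Literature.Probability.RandomPlanarGeometry.SLERestrictionSmoothProofs
import Literature.Probability.Process.PoissonCloudProofs
import HarnessLib

/-!
# [LSW] p. 5 result 2, uniqueness (`LawlerSchrammWerner2003_unique`): reduction to the six remaining printed leaves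

Proof-only glue for the named fact
`Literature.Probability.RandomPlanarGeometry.LawlerSchrammWerner2003_unique`
(`ConformalRestrictionProofs`), after

* G. F. Lawler, O. Schramm, W. Werner, *Conformal restriction: the chordal case*, J. Amer. Math.
  Soc. **16** (2003) 917–955, arXiv:math/0209343 (**[LSW]**), p. 5 result 2: "The only measure
  `P_α` that is supported on simple curves is `P_{5/8}`. It is the law of chordal SLE_{8/3}" —
  in the paper the conjunction of Lemma 3.2 (p. 10), Prop. 3.3 (pp. 10–13), Thm. 7.3 (p. 29)
  and Cor. 8.6 (pp. 37–38).

The tree proves the uniqueness statement from [LSW] Prop. 3.3 / Lemma 3.2 (pull-back to `ℍ`,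
Loewner chains, the slit Loewner theorem `IsArcHull.exists_loewner_chain_holds`) and the single
sentence "`α = 5/8` is forced" (`IsRestrictionMeasure.eq_five_eighths_of_outer_simple`,
`LawlerSchrammWerner2003_unique_of_loewner`, file `ConformalRestrictionLocal`); that sentence is
assembled from ten printed leaves in `RestrictionMeasuresFiveEighthsAssembly`
(`IsRestrictionMeasure.eq_five_eighths_of_outer_simple_of_ten_leaves`), four of which are
discharged in the tree: [LSW] Lemma 6.2 (`Loewner.restrictionDeriv_exitTime_gt_holds`),
Lemma 6.3 (`IsSmoothHull.restrictionDerivVanishesAtHit_holds`), Lemma 8.3 (2) on `(0, ∞)`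
(`SLEKappaRho.swallowingTime_ofReal_pos_holds`) and Kingman's existence theorem
(`Literature.Probability.Process.exists_isPoissonCloud_holds`).

Contents (no new named fact; everything PROVED):

* `Literature.Probability.RandomPlanarGeometry.LawlerSchrammWerner2003_unique_of_six_leaves` —
  `LawlerSchrammWerner2003_unique` from the SIX remaining leaves: the martingale of [LSW]
  Lemmas 8.9–8.10 (`SLEKappaRho.exists_isOneSidedMartingale`), the symmetry sentence for
  SLE_{8/3} (`measure_I_notMem_leftFilling_sle_eq_half`) and the comparison sentence
  (`SLEKappaRho.measure_I_notMem_fill_lt_of_neg`) of the proof of Cor. 8.6 (p. 38), a Brownian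
  bubble measure with interior points (`exists_isBrownianBubbleMeasure_ae_interior_nonempty`,
  §7.1), and the two halves of Thm. 7.3 (`SLEBubbles.exists_measurable_version`,
  `SLEBubbles.measure_disjoint`).

So the discharge `LawlerSchrammWerner2003_unique_holds` is exactly `…_of_six_leaves` applied to
the six `_holds` theorems of these named facts, once they exist (equivalently
`LawlerSchrammWerner2003_unique_of_loewner IsArcHull.exists_loewner_chain_holds
IsRestrictionMeasure.eq_five_eighths_of_outer_simple_holds`).

Mathlib: none beyond the imports. Tree: the assemblies and discharges quoted above.
-/

noncomputable section

open Literature.Probability.Process (exists_isPoissonCloud_holds)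

namespace Literature.Probability.RandomPlanarGeometry

/-- **[LSW] p. 5 result 2 (uniqueness of the restriction measure on simple curves) from the six
remaining leaves.** §8 side: the martingale of Lemmas 8.9–8.10 (`hM`), the symmetry sentence for
SLE_{8/3} (`h₀`) and the comparison sentence (`hlt`) of p. 38; §7 side: a Brownian bubble
measure with interior points (`hμex`), and Thm. 7.3 as the measurable version (`h₁`) and the
avoidance formula (`h₂`) of `Ξ(κ)`. Everything else — Lemma 3.2, Prop. 3.3 with the slit Loewner
theorem, Lemma 6.2, Lemma 6.3, Lemma 8.3 (2), §8.3, Kingman's theorem, the second halves of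
Thm. 8.4 and Cor. 8.6 — is proved in the tree.
[cite: LawlerSchrammWerner2003Restriction, p. 5 result 2; Lemma 3.2 (p. 10), Prop. 3.3 (pp. 10–13), Thm. 7.3 (p. 29), Cor. 8.6 (pp. 37–38)] -/
theorem LawlerSchrammWerner2003_unique_of_six_leaves
    (hM : SLEKappaRho.exists_isOneSidedMartingale)
    (h₀ : measure_I_notMem_leftFilling_sle_eq_half)
    (hlt : SLEKappaRho.measure_I_notMem_fill_lt_of_neg)
    (hμex : exists_isBrownianBubbleMeasure_ae_interior_nonempty)
    (h₁ : SLEBubbles.exists_measurable_version) (h₂ : SLEBubbles.measure_disjoint) :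
    LawlerSchrammWerner2003_unique :=
  LawlerSchrammWerner2003_unique_of_loewner IsArcHull.exists_loewner_chain_holds
    (IsRestrictionMeasure.eq_five_eighths_of_outer_simple_of_ten_leaves hM
      Loewner.restrictionDeriv_exitTime_gt_holds IsSmoothHull.restrictionDerivVanishesAtHit_holds
      SLEKappaRho.swallowingTime_ofReal_pos_holds h₀ hlt hμex exists_isPoissonCloud_holds h₁ h₂)

end Literature.Probability.RandomPlanarGeometry

end
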